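import Mathlib
import Summits.Ventures.PercRepro.TriangleCapBelowWindow

/-!
# PercRepro — THE B2 CORNER `(2a + r, a, r)` FOR EVERY ROW: the near-cap vertex (p3, gen 49; part 204a)

The induction of part 200zi (`below_second_order_all`) carries `a ≤ 18` for ONE reason: at the corner `k = 2a + r`
of the `B2` regime, with no vertex at the cap `k − a` and every degree `≥ a`, the degree sequence alone (the window
`[a, k − a − 1]`) reaches the `B2` target `2 (r − 1)(a − r)` only when `a (r − 2) ≤ 3r (r − 1)` — the first open corner
was `(41, 19, 3)`. Here the corner is closed by the structure of a NEAR-CAP vertex `x`, of degree `k − a − 1 = a + r − 1`: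
with `N = N(x)` (`a + r − 1` vertices, inducing a matching of `M` edges) and `R` the `a` non-neighbours, the edge count
`2m = 2|N| + 2M + 2P + E`, the degree bound `P + E ≤ a |N|` on `R` and `P ≤ a (|N| − M)` give `E ≥ 2 (a − 1) M − 4r + 2`,
so `M ≥ 1` forces an edge `u v` inside `R`; its ends share at most one neighbour in `N` (`K₄⁻`), and the count with
this pair gives `(a − 4) M ≤ 3r − a` — impossible for `a ≥ 3r + 1`, so `M = 0`; then an edge inside `R` would force
`E ≥ 2 (a − r − 1)` against `E ≤ 2 (2r − 1)`, impossible again — so `D ⊆ K(R ∪ {x}, N)` is `(a + 1)`-bipartite with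
`2r − 1` missing pairs and the bipartite closed form gives the target EXACTLY (`(2r − 1)(2a − r) = r (2a − 1) +
2 (r − 1)(a − r)`: the family `B2` itself). Without a near-cap vertex every degree lies in `[a, a + r − 2]` and that
window has slack `3r² − 5r + 2a > 0` (`corner_window_below`); and for `a ≤ 3r` the old window `[a, a + r − 1]` reaches
the target (`a (r − 2) ≤ 3r (r − 2) ≤ 3r (r − 1)`). So the corner closes for EVERY `(a, r)`: `below_corner_every`.
Axioms: standard.
-/

namespace PercRepro

namespace TriangleCap

namespace C047

open Finset

/-- The convexity term of a window `[a, U]`: `a ≤ d ≤ U` ⇒ `d² + a U ≤ (a + U) d`. -/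
theorem convex_window_gen (d a U : ℕ) (hd : a ≤ d) (hU : d ≤ U) : d * d + a * U ≤ (a + U) * d := by
  obtain ⟨u, rfl⟩ : ∃ u, d = a + u := ⟨d - a, by omega⟩
  obtain ⟨w, rfl⟩ : ∃ w, U = a + u + w := ⟨U - (a + u), by omega⟩
  nlinarith [Nat.zero_le (u * w)]

/-- At the corner `k = 2a + r` every degree in `[a, a + r − 2]` gives the `B2` target: the arithmetic
`(2a + r − 2) · 2m − a (a + r − 2)(2a + r) ≤ m (2a + r) − r (2a − 1) − 2 (r − 1)(a − r)`, slack `3r² − 5r + 2a`. -/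
theorem corner_window_below_arith (a r S m : ℕ) (har : r + 3 ≤ a) (hm : m + r = a * (a + r))
    (hS : S + a * (a + r - 2) * (2 * a + r) ≤ (2 * a + r - 2) * (2 * m)) :
    S + r * (2 * a + r - 1 - r) + 2 * (2 * a + r - 2 * a - 1) * (a - r) ≤ m * (2 * a + r) := by
  obtain ⟨q, rfl⟩ : ∃ q, a = r + 3 + q := ⟨a - (r + 3), by omega⟩
  have e1 : r + 3 + q + r - 2 = 2 * r + 1 + q := by omega
  have e2 : 2 * (r + 3 + q) + r - 2 = 2 * r + 4 + 2 * q + r := by omega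
  have e3 : 2 * (r + 3 + q) + r - 1 - r = 2 * r + 5 + 2 * q := by omega
  have e4 : 2 * (r + 3 + q) + r - 2 * (r + 3 + q) - 1 = r - 1 := by omega
  have e5 : r + 3 + q - r = 3 + q := by omega
  rw [e1, e2] at hS
  rw [e3, e4, e5]
  rcases Nat.eq_zero_or_pos r with hr0 | hr1
  · subst hr0
    simp only [Nat.zero_sub, zero_mul, mul_zero, add_zero, zero_add] at hS hm ⊢
    nlinarith [hS, hm]
  · obtain ⟨r', rfl⟩ : ∃ r', r = r' + 1 := ⟨r - 1, by omega⟩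
    have e6 : r' + 1 - 1 = r' := by omega
    rw [e6]
    nlinarith [hS, hm, Nat.zero_le (r' * r'), Nat.zero_le (r' * q)]

/-- The near-cap count: `2m = 2|N| + 2M + 2P + E`, `P ≤ a (|N| − M)`, `|N| = a + r − 1`, `m + r = a (a + r)` give
`E ≥ 2 (a − 1) M − 4r + 2`: for `M ≥ 1` and `a ≥ 2r + 1` there is an edge inside `R`. -/
theorem nearcap_E_pos (a r M P E m : ℕ) (h2r : 2 * r + 1 ≤ a) (hM1 : 1 ≤ M)
    (hdeg : (a + r - 1) + ((a + r - 1) + 2 * M + P) + (P + E) = 2 * m)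
    (h2 : P + a * M ≤ a * (a + r - 1)) (hmk : m + r = a * (a + r)) : 1 ≤ E := by
  have s1 : 1 ≤ a + r := by omega
  have haM : a * 1 ≤ a * M := Nat.mul_le_mul_left a hM1
  zify [s1] at hdeg h2 hmk haM
  nlinarith [hdeg, h2, hmk, haM]

/-- The near-cap count with an edge `u v` inside `R` (`P_u + P_v ≤ |N| + 1`, the other `a − 2` vertices at
`≤ |N| − M`): `(a − 4) M ≤ 3r − a` — impossible for `a ≥ 3r + 1` (whatever `M`). -/
theorem nearcap_M_arith (a r M P E m Pu Pv Pr : ℕ) (ha4 : 4 ≤ a) (h3r : 3 * r + 1 ≤ a)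
    (hdeg : (a + r - 1) + ((a + r - 1) + 2 * M + P) + (P + E) = 2 * m) (h1 : P + E ≤ a * (a + r - 1))
    (hmk : m + r = a * (a + r)) (hPuv : Pu + Pv ≤ (a + r - 1) + 1) (hrest : Pr + (a - 2) * M ≤ (a - 2) * (a + r - 1))
    (hPsum : P = Pu + (Pv + Pr)) : False := by
  have s1 : 1 ≤ a + r := by omega
  have s2 : 2 ≤ a := by omega
  have h4M : 4 * M ≤ a * M := Nat.mul_le_mul_right M (by omega)
  zify [s1, s2] at hdeg h1 hmk hPuv hrest hPsum h4M
  nlinarith [hdeg, h1, hmk, hPuv, hrest, hPsum, h4M]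

/-- The near-cap count with `M = 0` and an edge `u v` inside `R` (`P_u + P_v ≤ |N| + 1`, the other `a − 2` vertices
at `≤ |N|`): `E ≥ 2 (a − r − 1) > 2 (2r − 1)` for `a ≥ 4r + 1` — impossible. -/
theorem nearcap_E_arith (a r P E m Pu Pv Pr : ℕ) (har : r + 3 ≤ a) (h3r : 3 * r + 1 ≤ a)
    (hdeg : (a + r - 1) + ((a + r - 1) + 2 * 0 + P) + (P + E) = 2 * m) (h1 : P + E ≤ a * (a + r - 1))
    (hmk : m + r = a * (a + r)) (hPuv : Pu + Pv ≤ (a + r - 1) + 1) (hrest : Pr ≤ (a - 2) * (a + r - 1))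
    (hPsum : P = Pu + (Pv + Pr)) : False := by
  have s1 : 1 ≤ a + r := by omega
  have s2 : 2 ≤ a := by omega
  zify [s1, s2] at hdeg h1 hmk hPuv hrest hPsum
  nlinarith [hdeg, h1, hmk, hPuv, hrest, hPsum]

/-- The `(a + 1)`-bipartition of the near-cap graph has `2r − 1` missing pairs:
`m + (2r − 1) = (a + 1)(a + r − 1)` from `m + r = a (a + r)`. -/
theorem nearcap_edges_arith (a r m : ℕ) (hr1 : 1 ≤ r) (har : r + 3 ≤ a) (hmk : m + r = a * (a + r)) :
    m + (2 * r - 1) = (a + 1) * (a + r - 1) := by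
  obtain ⟨q, rfl⟩ : ∃ q, a = r + 3 + q := ⟨a - (r + 3), by omega⟩
  obtain ⟨r', rfl⟩ : ∃ r', r = r' + 1 := ⟨r - 1, by omega⟩
  have e2 : r' + 1 + 3 + q + (r' + 1) - 1 = 2 * r' + 4 + q := by omega
  have e3 : 2 * (r' + 1) - 1 = 2 * r' + 1 := by omega
  rw [e2, e3]
  nlinarith [hmk]

/-- At the corner `k = 2a + r`: `(2r − 1)(k − 1 − (2r − 1)) = r (k − 1 − r) + 2 (k − 2a − 1)(a − r)` — the bipartite
closed form of the `(a + 1)`-side is the `B2` target. -/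
theorem nearcap_gap_identity (a r : ℕ) (hr1 : 1 ≤ r) (har : r + 3 ≤ a) :
    (2 * r - 1) * (2 * a + r - 1 - (2 * r - 1)) =
      r * (2 * a + r - 1 - r) + 2 * (2 * a + r - 2 * a - 1) * (a - r) := by
  obtain ⟨q, rfl⟩ : ∃ q, a = r + 3 + q := ⟨a - (r + 3), by omega⟩
  have e1 : 2 * (r + 3 + q) + r - 1 - (2 * r - 1) = 2 * r + 6 + 2 * q - r := by omega
  have e2 : 2 * (r + 3 + q) + r - 1 - r = 2 * r + 5 + 2 * q := by omega
  have e3 : 2 * (r + 3 + q) + r - 2 * (r + 3 + q) - 1 = r - 1 := by omega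
  have e4 : r + 3 + q - r = 3 + q := by omega
  rw [e1, e2, e3, e4]
  obtain ⟨r', rfl⟩ : ∃ r', r = r' + 1 := ⟨r - 1, by omega⟩
  have e5 : 2 * (r' + 1) - 1 = 2 * r' + 1 := by omega
  have e6 : 2 * (r' + 1) + 6 + 2 * q - (r' + 1) = r' + 7 + 2 * q := by omega
  have e7 : r' + 1 - 1 = r' := by omega
  rw [e5, e6, e7]
  ring

variable {V : Type*} [Fintype V] [DecidableEq V]

omit [DecidableEq V] in
/-- **THE WINDOW `[a, U]`:** every degree in `[a, U]` gives `Σ_v d(v)² + a U k ≤ (a + U) · 2m`. -/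
theorem sum_deg_sq_le_of_window (D : SimpleGraph V) [DecidableRel D.Adj] (a U : ℕ) (hdeg : ∀ v, a ≤ deg D v)
    (hup : ∀ v, deg D v ≤ U) :
    ∑ v, deg D v * deg D v + a * U * Fintype.card V ≤ (a + U) * (2 * D.edgeFinset.card) := by
  have hsum : ∑ v, (deg D v * deg D v + a * U) ≤ ∑ v, (a + U) * deg D v :=
    sum_le_sum (fun v _ => convex_window_gen (deg D v) a U (hdeg v) (hup v))
  rw [sum_add_distrib, sum_const, card_univ, smul_eq_mul, ← mul_sum, sum_deg_eq] at hsum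
  rw [mul_comm (Fintype.card V) (a * U)] at hsum
  exact hsum

omit [DecidableEq V] in
/-- **THE CORNER WITHOUT A NEAR-CAP VERTEX:** `k = 2a + r`, every degree in `[a, k − a − 2]` ⇒ the `B2` target, for
every `a ≥ r + 3`. -/
theorem corner_window_below (D : SimpleGraph V) [DecidableRel D.Adj] (a r : ℕ) (har : r + 3 ≤ a)
    (hk : Fintype.card V = 2 * a + r) (hm : D.edgeFinset.card + r = a * (Fintype.card V - a))
    (hup : ∀ v, deg D v + a + 2 ≤ Fintype.card V) (hdeg : ∀ v, a ≤ deg D v) :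
    ∑ v, deg D v * deg D v + r * (Fintype.card V - 1 - r) + 2 * (Fintype.card V - 2 * a - 1) * (a - r) ≤
      D.edgeFinset.card * Fintype.card V := by
  have h := sum_deg_sq_le_of_window D a (a + r - 2) hdeg (fun v => by have := hup v; omega)
  rw [hk] at h hm ⊢
  have e : 2 * a + r - a = a + r := by omega
  rw [e] at hm
  have e' : a + (a + r - 2) = 2 * a + r - 2 := by omega
  rw [e'] at h
  exact corner_window_below_arith a r _ _ har hm h

/-- **THE NEAR-CAP VERTEX AT THE CORNER:** `k = 2a + r`, `r + 3 ≤ a`, `4r + 1 ≤ a`, no vertex at the cap `k − a`, a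
vertex `x` of degree `k − a − 1` ⇒ `D` is `(a + 1)`-bipartite with `2r − 1` missing pairs and the `B2` target holds. -/
theorem corner_nearcap (D : SimpleGraph V) [DecidableRel D.Adj] (hK : K4mFree D) (a r : ℕ) (hr1 : 1 ≤ r)
    (har : r + 3 ≤ a) (h3r : 3 * r + 1 ≤ a) (hk : Fintype.card V = 2 * a + r)
    (hm : D.edgeFinset.card + r = a * (Fintype.card V - a)) (hcap : ∀ v, deg D v + a + 1 ≤ Fintype.card V)
    (x : V) (hx : deg D x + a + 1 = Fintype.card V) :
    ∑ v, deg D v * deg D v + r * (Fintype.card V - 1 - r) + 2 * (Fintype.card V - 2 * a - 1) * (a - r) ≤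
      D.edgeFinset.card * Fintype.card V := by
  obtain ⟨N, hN⟩ : ∃ N : Finset V, N = univ.filter (fun w => D.Adj x w) := ⟨_, rfl⟩
  have hmemN : ∀ w, w ∈ N ↔ D.Adj x w := fun w => by rw [hN, mem_filter]; simp only [mem_univ, true_and]
  have hxN : x ∉ N := fun h => D.irrefl ((hmemN x).mp h)
  have hdx : deg D x = N.card := by rw [hN]; rfl
  have hKdef : N.card = a + r - 1 := by omega
  obtain ⟨m, hmdef⟩ : ∃ m, D.edgeFinset.card = m := ⟨_, rfl⟩
  rw [hmdef] at hm
  obtain ⟨R, hR⟩ : ∃ R : Finset V, R = (insert x N)ᶜ := ⟨_, rfl⟩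
  have hRcard : R.card = a := by
    rw [hR, card_compl, card_insert_of_notMem hxN]
    omega
  have hmemR : ∀ w, w ∈ R ↔ w ≠ x ∧ ¬ D.Adj x w := by
    intro w
    rw [hR, mem_compl, mem_insert, hmemN]
    tauto
  obtain ⟨M, hM⟩ : ∃ M, adjPairs D N = 2 * M := ⟨_, adjPairs_eq_two_mul D N⟩
  have hTf : ∑ y ∈ N, degIn D N y = 2 * M := by rw [← adjPairs_eq_sum_degIn, hM]
  obtain ⟨P, hPdef⟩ : ∃ P, ∑ u ∈ R, degIn D N u = P := ⟨_, rfl⟩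
  obtain ⟨E, hEdef⟩ : ∃ E, adjPairs D R = E := ⟨_, rfl⟩
  have hsplit : ∀ F : V → ℕ, ∑ w, F w = F x + ∑ y ∈ N, F y + ∑ u ∈ R, F u := by
    intro F
    rw [← sum_add_sum_compl (insert x N), sum_insert hxN, ← hR]
  have hdegN : ∀ y ∈ N, deg D y = 1 + degIn D N y + degIn D R y := by
    intro y hy
    have := deg_eq_of_mem_nbhd D x y ((hmemN y).mp hy)
    rw [← hN, ← hR] at this
    exact this
  have hsumN : ∑ y ∈ N, deg D y = (a + r - 1) + 2 * M + P := by
    rw [sum_congr rfl hdegN, sum_add_distrib, sum_add_distrib, sum_const, smul_eq_mul, mul_one, hKdef, hTf,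
      sum_degIn_comm D N R, hPdef]
  have hdegR : ∀ u ∈ R, deg D u = degIn D N u + degIn D R u := by
    intro u hu
    have := deg_eq_of_not_mem_nbhd D x u ((hmemR u).mp hu).2
    rw [← hN, ← hR] at this
    exact this
  have hsumR : ∑ u ∈ R, deg D u = P + E := by
    rw [sum_congr rfl hdegR, sum_add_distrib, hPdef, ← adjPairs_eq_sum_degIn, hEdef]
  have hdegsum := sum_deg_eq D
  rw [hsplit, hsumN, hsumR, hdx, hKdef, hmdef] at hdegsum
  have hcapK : ∀ u ∈ R, deg D u ≤ a + r - 1 := fun u _ => by have := hcap u; omega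
  have h1 : P + E ≤ a * (a + r - 1) := by
    rw [← hsumR]
    calc ∑ u ∈ R, deg D u ≤ ∑ _u ∈ R, (a + r - 1) := sum_le_sum (fun u hu => hcapK u hu)
      _ = a * (a + r - 1) := by rw [sum_const, smul_eq_mul, hRcard]
  have hPle : ∀ u ∈ R, degIn D N u + M ≤ a + r - 1 := by
    intro u hu
    have := two_mul_degIn_add_adjPairs_le D hK (x := x) ((hmemR u).mp hu).1
    rw [← hN, hM, hKdef] at this
    omega
  have h2 : P + a * M ≤ a * (a + r - 1) := by
    have hs : ∑ u ∈ R, (degIn D N u + M) ≤ ∑ _u ∈ R, (a + r - 1) := sum_le_sum hPle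
    rw [sum_add_distrib, sum_const, sum_const, smul_eq_mul, smul_eq_mul, hPdef, hRcard] at hs
    exact hs
  have hmk : m + r = a * (a + r) := by
    have e : Fintype.card V - a = a + r := by omega
    rw [e] at hm
    exact hm
  -- an edge inside `R` whenever `E ≠ 0`
  have hedge : E ≠ 0 → ∃ u ∈ R, ∃ v ∈ R, D.Adj u v := by
    intro hE
    obtain ⟨u, hu, hu1⟩ : ∃ u ∈ R, 1 ≤ degIn D R u := by
      by_contra hcon
      push Not at hcon
      have h0 : ∑ u ∈ R, degIn D R u = 0 := sum_eq_zero (fun u hu => by have := hcon u hu; omega)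
      rw [← adjPairs_eq_sum_degIn, hEdef] at h0
      exact hE h0
    obtain ⟨v, hv, huv⟩ : ∃ v ∈ R, D.Adj u v := by
      unfold degIn at hu1
      obtain ⟨v, hv⟩ := card_pos.mp hu1
      rw [mem_filter] at hv
      exact ⟨v, hv.1, hv.2⟩
    exact ⟨u, hu, v, hv, huv⟩
  -- the count with the pair `u v`: `P_u + P_v ≤ |N| + 1`, the others at `≤ |N| − M`
  have hpair : ∀ u ∈ R, ∀ v ∈ R, D.Adj u v → ∃ Pu Pv Pr, Pu + Pv ≤ (a + r - 1) + 1 ∧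
      Pr + (a - 2) * M ≤ (a - 2) * (a + r - 1) ∧ P = Pu + (Pv + Pr) := by
    intro u hu v hv huv
    have hne : u ≠ v := D.ne_of_adj huv
    have hPuv : degIn D N u + degIn D N v ≤ (a + r - 1) + 1 := by
      have := degIn_add_degIn_le_of_adj_pair D hK N huv
      rw [hKdef] at this
      exact this
    have hvR' : v ∈ R.erase u := mem_erase.mpr ⟨hne.symm, hv⟩
    have hsum1 := add_sum_erase R (fun w => degIn D N w) hu
    have hsum2 := add_sum_erase (R.erase u) (fun w => degIn D N w) hvR'
    have hcard2 : ((R.erase u).erase v).card = a - 2 := by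
      rw [card_erase_of_mem hvR', card_erase_of_mem hu]
      omega
    have hrest : ∑ w ∈ (R.erase u).erase v, degIn D N w + (a - 2) * M ≤ (a - 2) * (a + r - 1) := by
      have hs : ∑ w ∈ (R.erase u).erase v, (degIn D N w + M) ≤ ∑ _w ∈ (R.erase u).erase v, (a + r - 1) :=
        sum_le_sum (fun w hw => hPle w (mem_of_mem_erase (mem_of_mem_erase hw)))
      rw [sum_add_distrib, sum_const, sum_const, smul_eq_mul, smul_eq_mul, hcard2] at hs
      exact hs
    have hPsum : P = degIn D N u + (degIn D N v + ∑ w ∈ (R.erase u).erase v, degIn D N w) := by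
      rw [← hPdef, ← hsum1, ← hsum2]
    exact ⟨_, _, _, hPuv, hrest, hPsum⟩
  -- `M = 0`: otherwise `E ≥ 1`, and the pair count gives `(a − 4) M ≤ 3r − a < 0`
  have hM0 : M = 0 := by
    by_contra hM
    have hM1 : 1 ≤ M := by omega
    have hE1 := nearcap_E_pos a r M P E m (by omega) hM1 hdegsum h2 hmk
    obtain ⟨u, hu, v, hv, huv⟩ := hedge (by omega)
    obtain ⟨Pu, Pv, Pr, hPuv, hrest, hPsum⟩ := hpair u hu v hv huv
    exact nearcap_M_arith a r M P E m Pu Pv Pr (by omega) h3r hdegsum h1 hmk hPuv hrest hPsum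
  subst hM0
  -- no edge inside `R`: an edge `u v` would force `E ≥ 2 (a − r − 1) > 2 (2r − 1)`
  have hE0 : E = 0 := by
    by_contra hE
    obtain ⟨u, hu, v, hv, huv⟩ := hedge hE
    obtain ⟨Pu, Pv, Pr, hPuv, hrest, hPsum⟩ := hpair u hu v hv huv
    rw [mul_zero, add_zero] at hrest
    exact nearcap_E_arith a r P E m Pu Pv Pr har h3r hdegsum h1 hmk hPuv hrest hPsum
  have hnoR : ∀ u ∈ R, degIn D R u = 0 := by
    intro u hu
    have hle : degIn D R u ≤ ∑ z ∈ R, degIn D R z := single_le_sum (fun _ _ => Nat.zero_le _) hu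
    rw [← adjPairs_eq_sum_degIn, hEdef, hE0] at hle
    exact Nat.le_zero.mp hle
  -- `D ⊆ K(Nᶜ, N)`, `|Nᶜ| = a + 1`
  have hnoN : ∀ y ∈ N, ∀ y', D.Adj y y' → y' ∉ N := by
    intro y hy y' hyy' hy'
    have h0 : degIn D N y = 0 := by
      have hle : degIn D N y ≤ ∑ z ∈ N, degIn D N z := single_le_sum (fun _ _ => Nat.zero_le _) hy
      rw [hTf, mul_zero] at hle
      exact Nat.le_zero.mp hle
    unfold degIn at h0
    rw [card_eq_zero, filter_eq_empty_iff] at h0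
    exact h0 hy' hyy'
  have hnoR' : ∀ u ∈ R, ∀ u', D.Adj u u' → u' ∉ R := by
    intro u hu u' huu' hu'
    have h0 := hnoR u hu
    unfold degIn at h0
    rw [card_eq_zero, filter_eq_empty_iff] at h0
    exact h0 hu' huu'
  have hB : BipSub D Nᶜ := by
    intro p q hpq
    rw [mem_compl, mem_compl, not_not]
    constructor
    · intro hpN
      by_contra hqN
      by_cases hpx : p = x
      · subst hpx
        exact hqN ((hmemN q).mpr hpq)
      by_cases hqx : q = x
      · subst hqx
        exact hpN ((hmemN p).mpr (D.adj_symm hpq))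
      have hpR : p ∈ R := (hmemR p).mpr ⟨hpx, fun h => hpN ((hmemN p).mpr h)⟩
      have hqR : q ∈ R := (hmemR q).mpr ⟨hqx, fun h => hqN ((hmemN q).mpr h)⟩
      exact hnoR' p hpR q hpq hqR
    · intro hqN hpN
      exact hnoN p hpN q hpq hqN
  have hNc : Nᶜ.card = a + 1 := by
    rw [card_compl, hKdef]
    omega
  have hm' : D.edgeFinset.card + (2 * r - 1) = (a + 1) * (Fintype.card V - (a + 1)) := by
    rw [hmdef, hk]
    have e : 2 * a + r - (a + 1) = a + r - 1 := by omega
    rw [e]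
    exact nearcap_edges_arith a r m hr1 har hmk
  have hbound := sum_deg_sq_le_of_bipSub D Nᶜ hB (a + 1) (2 * r - 1) hNc hm' (by omega)
  -- `(2r − 1)(k − 1 − (2r − 1)) = r (k − 1 − r) + 2 (k − 2a − 1)(a − r)` at `k = 2a + r`
  have e : (2 * r - 1) * (Fintype.card V - 1 - (2 * r - 1)) =
      r * (Fintype.card V - 1 - r) + 2 * (Fintype.card V - 2 * a - 1) * (a - r) := by
    rw [hk]
    exact nearcap_gap_identity a r hr1 har
  rw [e, ← add_assoc] at hbound
  exact hbound

/-- The window arithmetic at the corner for `a ≤ 3r`: `2 (r − 1)(a − r) ≤ a r + r (r − 1)`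
(`a (r − 2) ≤ 3r (r − 2) ≤ 3r (r − 1)`). -/
theorem corner_window_arith_every (a r : ℕ) (h3 : a ≤ 3 * r) (har : r + 3 ≤ a) :
    2 * (r - 1) * (a - r) ≤ a * r + r * (r - 1) := by
  obtain ⟨q, rfl⟩ : ∃ q, a = r + 3 + q := ⟨a - (r + 3), by omega⟩
  obtain ⟨r', rfl⟩ : ∃ r', r = r' + 1 := ⟨r - 1, by omega⟩
  have e1 : r' + 1 - 1 = r' := by omega
  have e2 : r' + 1 + 3 + q - (r' + 1) = 3 + q := by omega
  rw [e1, e2]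
  nlinarith [h3, Nat.zero_le (r' * q), Nat.zero_le (r' * r')]

omit [DecidableEq V] in
/-- **THE CORNER `k = 2a + r` FOR EVERY ROW:** no vertex at the cap, every degree `≥ a`, `r + 3 ≤ a`, `2a + 2 ≤ k` ⇒
the `B2` target (the near-cap vertex or the window `[a, a + r − 2]` for `a ≥ 3r + 1`; the window `[a, a + r − 1]`
for `a ≤ 3r`). -/
theorem below_corner_every (D : SimpleGraph V) [DecidableRel D.Adj] (hK : K4mFree D) (a r : ℕ) (har : r + 3 ≤ a)
    (hk2 : 2 * a + 2 ≤ Fintype.card V) (hk : Fintype.card V = 2 * a + r)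
    (hm : D.edgeFinset.card + r = a * (Fintype.card V - a)) (hcap : ∀ v, deg D v + a + 1 ≤ Fintype.card V)
    (hdeg : ∀ v, a ≤ deg D v) :
    ∑ v, deg D v * deg D v + r * (Fintype.card V - 1 - r) + 2 * (Fintype.card V - 2 * a - 1) * (a - r) ≤
      D.edgeFinset.card * Fintype.card V := by
  classical
  by_cases h3 : 3 * r + 1 ≤ a
  · by_cases hx : ∃ x, deg D x + a + 1 = Fintype.card V
    · obtain ⟨x, hx⟩ := hx
      exact corner_nearcap D hK a r (by omega) har h3 hk hm hcap x hx
    · push Not at hx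
      exact corner_window_below D a r har hk hm (fun v => by have := hcap v; have := hx v; omega) hdeg
  · have h := below_window_gen D a r (by omega) (by omega) hm hcap hdeg
    have harith := corner_window_arith_every a r (by omega) har
    have e1 : Fintype.card V - 2 * a = r := by omega
    have e2 : Fintype.card V - 2 * a - 1 = r - 1 := by omega
    rw [e1] at h
    rw [e2]
    omega

end C047

end TriangleCap

end PercRepro
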